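import Literature.AnabelianGeometry.EtaleTheta.Discharge.Sec1ThetaCompactOfYcl
import Literature.AnabelianGeometry.EtaleTheta.EtaleThetaClass
import HarnessLib

/-!
# [EtTh] §1: the topology of the theta quotients as ONE root predicate `ThetaSetting.HasThetaTopology`
# (additive, class (c); 13:00Z v-next census item S1-1 / C2)

Mochizuki, *The étale theta function and its Frobenioid-theoretic manifestations*, Publ. RIMS **45** (2009), §1,
PRIMS PDF pp. 12–13 (printed 238–239): «we shall write Π^tp_X ↠ (Π^tp_X)^Θ ↠ (Π^tp_X)^ell for the quotients whose
kernels are the kernels of the quotients Δ^tp_X ↠ (Δ^tp_X)^Θ ↠ (Δ^tp_X)^ell» (quotient TOPOLOGICAL groups) and «we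
have a natural exact sequence of abelian profinite groups 1 → Δ_Θ → (Δ^tp_Y)^Θ → (Δ^tp_Y)^ell → 1»
[cite: MochizukiEtTh2009, §1 p.12]. abc-iut cell, layer L2, seat abc-iut-L2-t1 (§1 ROOT owner lineage; ONE WRITER of
`Setting.lean`). 13:00Z v-next census, item S1-1 of `VNEXT-S1.md` / §C0 of abc-iut-L2-t3 g4's draft: the frozen root
`ThetaSetting` v3 records `toTheta`, `thetaToEll` with `Continuous` + `Surjective` only; the printed topological clauses
— R3 «quotient maps» and «(Δ^tp_Y)^Θ profinite (compact)» — are carried by ≥ 20 consumer files as the binders `hq`,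
`hYcl` (GAP G-w4d021-2), `hΔ` (GAP G-w5d187-1). Drafter's CALL (rule §0a): an in-place FIELD would un-build the discrete
ROOT MODEL `ThetaSetting.model p` (p421399; it fails `hYcl` BY DESIGN — `SettingModel.hYcl_not_derivable` p421746) and the
independence certificates ⇒ class-(c) PREDICATE now. THIS FILE is that predicate, by the root owner, with the derived
binders PROVED by name (abc-iut-L5-t14 `closure_map_dtpY_le_of_isQuotientMap`, abc-iut-w5-d111
`Sec1ThetaCompactOfYcl`): nothing asserted, no field of a frozen structure touched.

* `ThetaSetting.HasThetaTopology D` — R3 (`IsQuotientMap toTheta`, `IsQuotientMap thetaToEll`) ∧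
  «(Δ^tp_Y)^Θ compact»;
* `HasThetaTopology.hYcl` (= G-w4d021-2), `.t2Space_gtpTheta`, `.t2Space_gtpEll`, `.isClosed_deltaTheta`,
  `.isCompact_deltaTheta` / `.hDelta` (= G-w5d187-1, under `Compat`);
* `HasThetaTopology.of_isQuotientMap` / `.of_hYcl` — constructors from R3 + compactness of `(Δ^tp_Y)^Θ`, resp. from
  R3 + `hYcl` + the §6 parameter bundle (abc-iut-L2-t6's origin predicate `IsThm16Origin` supplies R3: use
  `of_isQuotientMap h16.isQuotientMap_toTheta h16.isQuotientMap_thetaToEll hc` at the consumer — not imported here).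
NV (separate proof-only file over the R78 models): holds at `ThetaSetting.modelχ p` / `modelχq`, fails at the discrete
root model. HONEST FRAMING: [EtTh] is refereed; nothing here bears on [IUTchIII] Cor. 3.12; typed ≠ proved.
-/

noncomputable section

namespace Literature.AnabelianGeometry.EtaleTheta

open Literature.AnabelianGeometry.SemiGraphs Topology

namespace ThetaSetting

variable {p : ℕ} [Fact p.Prime] {D : ThetaSetting p}

/-- **The printed topology of the theta quotients** (pp. 12–13): `Π^tp_X ↠ (Π^tp_X)^Θ` and
`(Π^tp_X)^Θ ↠ (Π^tp_X)^ell` are topological QUOTIENT maps («we shall write … for the quotients», R3 of the K3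
sub-DAG) and `(Δ^tp_Y)^Θ` is compact («a natural exact sequence of abelian profinite groups
1 → Δ_Θ → (Δ^tp_Y)^Θ → (Δ^tp_Y)^ell → 1»). A predicate on `D`; inhabited at the semi-synthetic models, false at the
discrete root model; never asserted. [cite: MochizukiEtTh2009, §1 p.12] -/
structure HasThetaTopology (D : ThetaSetting p) : Prop where
  /-- R3: `(Π^tp_X)^Θ` carries the quotient topology. -/
  isQuotientMap_toTheta : IsQuotientMap D.toTheta
  /-- R3: `(Π^tp_X)^ell` carries the quotient topology of `(Π^tp_X)^Θ`. -/
  isQuotientMap_thetaToEll : IsQuotientMap D.thetaToEll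
  /-- «(Δ^tp_Y)^Θ … profinite»: the image of `Δ^tp_Y` in `(Π^tp_X)^Θ` is compact. -/
  isCompact_dtpYTheta : IsCompact ((D.DtpYTheta : Subgroup D.GtpTheta) : Set D.GtpTheta)

namespace HasThetaTopology

/-- **`hYcl` (GAP G-w4d021-2) from the predicate**: «the image of Δ^tp_Y in Δ^Θ_X = Δ_X/[[Δ_X,Δ_X],Δ_X]⁻ is
closed» (abc-iut-L5-t14's `closure_map_dtpY_le_of_isQuotientMap`). [cite: MochizukiEtTh2009, §1 p.12] -/
theorem hYcl (h : D.HasThetaTopology) :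
    (D.DtpY.map D.toHat.toMonoidHom).topologicalClosure ≤
      D.DtpY.map D.toHat.toMonoidHom ⊔ (⁅⁅D.DeltaHat, D.DeltaHat⁆, D.DeltaHat⁆).topologicalClosure :=
  D.closure_map_dtpY_le_of_isQuotientMap h.isQuotientMap_toTheta h.isCompact_dtpYTheta

/-- `(Π^tp_X)^Θ` is Hausdorff (abc-iut-w5-d111). [cite: MochizukiEtTh2009, §1 p.12] -/
theorem t2Space_gtpTheta (h : D.HasThetaTopology) : T2Space D.GtpTheta :=
  D.t2Space_gtpTheta_of_isQuotientMap h.isQuotientMap_toTheta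

/-- `(Π^tp_X)^ell` is Hausdorff (abc-iut-w5-d111). [cite: MochizukiEtTh2009, §1 p.12] -/
theorem t2Space_gtpEll (h : D.HasThetaTopology) : T2Space D.GtpEll :=
  D.t2Space_gtpEll_of_isQuotientMap h.isQuotientMap_toTheta h.isQuotientMap_thetaToEll

/-- `Δ_Θ` is closed in `(Π^tp_X)^Θ` (abc-iut-w5-d111). [cite: MochizukiEtTh2009, §1 p.12] -/
theorem isClosed_deltaTheta (h : D.HasThetaTopology) :
    IsClosed ((D.DeltaTheta : Subgroup D.GtpTheta) : Set D.GtpTheta) :=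
  D.isClosed_deltaTheta_of_isQuotientMap h.isQuotientMap_toTheta h.isQuotientMap_thetaToEll

/-- **`Δ_Θ` is compact** («abelian profinite», p. 12) under `Compat` (`Δ_Θ ≤ (Δ^tp_Y)^Θ`): the compactness half of
GAP G-w5d187-1's `hΔ`, with NO Galois-countability / temperedness input. [cite: MochizukiEtTh2009, §1 p.12] -/
theorem isCompact_deltaTheta (h : D.HasThetaTopology) (hC : D.Compat) :
    IsCompact ((D.DeltaTheta : Subgroup D.GtpTheta) : Set D.GtpTheta) :=
  h.isCompact_dtpYTheta.of_isClosed_subset h.isClosed_deltaTheta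
    (fun _ hx => hC.deltaTheta_le_DtpYTheta hx)

/-- **`hΔ` (GAP G-w5d187-1) from the predicate**: `Δ_Θ` compact and `(Π^tp_X)^Θ` Hausdorff.
[cite: MochizukiEtTh2009, §1 p.12] -/
theorem hDelta (h : D.HasThetaTopology) (hC : D.Compat) :
    IsCompact ((D.DeltaTheta : Subgroup D.GtpTheta) : Set D.GtpTheta) ∧ T2Space D.GtpTheta :=
  ⟨h.isCompact_deltaTheta hC, h.t2Space_gtpTheta⟩

/-- From abc-iut-L2-t6's origin predicate: R3 is two of its clauses, so `IsThm16Origin` + compactness of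
`(Δ^tp_Y)^Θ` give `HasThetaTopology`. [cite: MochizukiEtTh2009, §1 p.12] -/
theorem of_isQuotientMap (hq : IsQuotientMap D.toTheta) (hq' : IsQuotientMap D.thetaToEll)
    (hc : IsCompact ((D.DtpYTheta : Subgroup D.GtpTheta) : Set D.GtpTheta)) : D.HasThetaTopology :=
  ⟨hq, hq', hc⟩

/-- With the §6 parameter bundle (tempered + Galois-countable) the compactness clause is EQUIVALENT to `hYcl`
(abc-iut-w5-d111's `closure_map_dtpY_le_iff_isCompact_dtpYTheta_of_groupLevelData`): so under R3 + `hYcl` +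
`GroupLevelData` the predicate holds. [cite: MochizukiEtTh2009, §1 p.12] -/
theorem of_hYcl (d : D.toTemperedCurve.GroupLevelData) (hq : IsQuotientMap D.toTheta)
    (hq' : IsQuotientMap D.thetaToEll)
    (hYcl : (D.DtpY.map D.toHat.toMonoidHom).topologicalClosure ≤
      D.DtpY.map D.toHat.toMonoidHom ⊔ (⁅⁅D.DeltaHat, D.DeltaHat⁆, D.DeltaHat⁆).topologicalClosure) :
    D.HasThetaTopology :=
  ⟨hq, hq', D.isCompact_dtpYTheta_of_groupLevelData d hYcl⟩

end HasThetaTopology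

end ThetaSetting

end Literature.AnabelianGeometry.EtaleTheta

end
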